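import Literature.MathematicalPhysics.QuantumFieldTheory.Balaban1983to89.B12SecondOrder267Concrete
import Literature.MathematicalPhysics.QuantumFieldTheory.Balaban1983to89.B11Eq63FunctionalDerivative

/-!
# `Balaban1983to89.B11Eq70Concrete` — T. Bałaban, *The variational problem and background fields in renormalization group method for
lattice gauge theories*, Commun. Math. Phys. **102** (1985) 277–309 [Balaban1985Variational], (63)–(70) pp. 287–289: **THE FUNCTIONAL
DERIVATIVE `𝔇(A′) = (δ/δA′)D(A′)` EXISTS AND EQUALS `(I + ℜ)⁻¹·(δC_j/δA)(A′ − HD(A′))` (70), WITH `‖ℜ‖ ≤ 9C₂B₀ε₃ < 1` (69), FOR THE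
CONCRETE REMAINDER `C_j(U₀, ·)` OF [4] ON THE `ℤᵈ` CARRIER** — r08's `B11Eq63FunctionalDerivative` (implicit function theorem, Neumann
series, Cauchy estimate (69)) with EVERY hypothesis on `C_j` and on `D` DISCHARGED: (49) near `A′`, strict differentiability of `C`
([4] Prop. 4 concretely), continuity of `D` (its joint analyticity, `B12SecondOrder267Concrete.analyticOnNhd_Dt_concrete`), invertibility of
`I + ℜ` (from (69) in operator norm)

statement-level skeleton of published theorems with citation tags; proofs where landed; nothing here is a claim about the Yang–Mills mass gap

PDF held: `paper:balaban1985-cmp102-variational-background` (journal page = PDF page + 276); pp. 287–289 [PDF 11–13], text layer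
`p0011.txt`–`p0013.txt` and the renders `run/shared/lean/pub/pub-balaban/b2b-balaban-ref1/pages/1985-cmp102-variational-background/…-p011-x2.png`
–`p013-x2.png` (read by r08 gen 3; statements quoted from that module's header); [4] = `paper:balaban1985-cmp98-averaging` p. 38.

CITATION HEADER / WHAT IS REPRODUCED.  Cell `lit-balaban`, Phase-2 proof seat p06 gen 6 = unit `lit-balaban-p06` (TAKING addendum HOME/STATUS.md
2026-08-21T11:4xZ); SKELETON rows **B11.Eq63** ((63)–(69)) and **B11.Eq70** ((70)); owner r08 (HOME/lit-balaban-r08/ROWS-B11.md: «EXISTENCE of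
𝔇 = (δ/δA′)D(A′) as a strict Fréchet derivative + (70) 𝔇 = (I+ℜ)⁻¹𝒞′ PROVED by the implicit function theorem from (49) near A′, strict
differentiability of the rescaled C at X₀ = A′ − HD(A′), continuity of D (PROVED from the contraction (54)) and invertibility of I + ℜ» — all
as HYPOTHESES on abstract `𝒞`, `H`, `D`).  THE PRINT.  p. 287: *«⟨(δ/δA′)D(A′), δA′⟩ = (d/dτ)D(A′ + τδA′)|_{τ=0}. (63)»*; p. 288: *«This gives
the following equation on 𝔇: [I + Lʲη⟨(δC_j/δA)(Lʲη(A′ − HD(A′))), H⟩]𝔇(A′) = Lʲη(δC_j/δA)(Lʲη(A′ − HD(A′))) on Λ_j. (68) … We have the bound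
|(Lʲη⟨(δC_j/δA)(…), H⟩)(c, c′)| = |(d/dτ)C_j(Lʲη(A′ − HD(A′)) + τH(·, c′), c)|_{τ=0}| … ≤ (1/r)C₂(2ε₃ + r sup|H(b, c′)|)² ≤ … = 9C₂B₀ε₃(L^{j′}η)^{−d}
e^{−δ₀d(c₋,c′₋)}, (69) … The above bound shows that the operator in the square bracket in (68) (without the identity operator) is of the same
type as the operators R studied in [3, 5]. Let us denote it by ℜ. Equation (68) is uniquely solvable by a convergent Neumann series,
𝔇(A′) = (I + ℜ)⁻¹L^{j(·)}η((δ/δA)C)(A′ − HD(A′)), (70)»*; p. 286: *«This solution … is an analytic function of A′»*, *«9C₂B₀ε₃ < 1»* (54).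

DICTIONARY (as `B11Eq44Concrete` / `B12SecondOrder267Concrete`: tree units, scales absorbed, sup norms).  `𝒴 = 𝔸^S ∋ A′`, `𝒳 = 𝔸^T ∋ D(A′)`;
`Cmap a = (C_j(U₀, ins_S a)(c))_{c∈T}` = the print's rescaled `C` of p. 289; `H : 𝔸^T →L[ℂ] 𝔸^S` continuous linear with `‖HX‖ ≤ B₀‖X‖`
((46); abstract, as in the rows B11.Eq45/B11.Eq63); `D̃ = Dt : 𝔸^S → 𝔸^T` ANY map with the fixed-point characterization (49)+(55) on the ball
`‖A′‖ < ε` (such a map exists and is unique in the ball: `B12SecondOrder267Concrete.exists_Dt_concrete`, `B11Eq44Concrete.exists_unique_fixedPoint_concrete`);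
`X₀ = A′ − H D̃(A′)`; `𝒞′ = fderiv ℂ Cmap X₀` (the print's `Lʲη(δC_j/δA)(Lʲη(A′ − HD(A′)))`); `ℜ = 𝒞′ ∘L H`; print's `C₂` ↦ `C₂(Lʲ)²` with
`C₂ = 8·C₁·e^{4cα₀}` (local notation), `ε₃` ↦ `ε`.  Regime = `B11Eq44Concrete`'s (regular background `U₀`, witness radius `b`, [4] smallness,
`j ≤ k`) with the contraction hypotheses «9C₂B₀ε₃ < 1», and `3ε < b` (the circle of (69) of radius `r = ε/‖h‖` around `X₀`, `‖X₀‖ ≤ 2ε`, must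
stay INSIDE the analyticity ball `‖·‖ < b` of (44); r08's `ineq69` takes `3ε₃ < R` likewise).

WHAT THIS FILE PROVES (theorems only; kernel, 0 sorry, standard axioms), for `j ≤ k`:
* §1 **(69) IN OPERATOR NORM, CONCRETE**: `norm_fderiv_Cmap_apply_le` (`‖𝒞′(X₀)h‖ ≤ 9C₂(Lʲ)²ε·‖h‖` for `‖X₀‖ ≤ 2ε`, `0 < ε`, `3ε < b` — r08's
  `ineq69` fed with `quadAnalytic_Cmap` and (63) for `C_j`, `eq69_line1`), `opNorm_fderiv_Cmap_le`, **`opNorm_R_le`** (`‖ℜ‖ ≤ 9C₂(Lʲ)²ε·B₀`),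
  `opNorm_R_lt_one` (under (54) `9C₂(Lʲ)²B₀ε < 1`), `isInvertible_one_add_R` («(68) is uniquely solvable»).
* §2 the hypotheses of r08's §3 for the CONCRETE data: `norm_X₀_le` (`‖A′ − HD̃(A′)‖ ≤ 2ε`, (57)), `eventually_eq49` ((49) near `A′`),
  `hasStrictFDerivAt_Cmap_X₀` ([4] Prop. 4: `Cmap` analytic at `X₀`), `continuousAt_Dt` (p. 286, from `analyticOnNhd_Dt_concrete`).
* §3 **(63)/(70) FOR THE CONCRETE `C_j`**: **`hasStrictFDerivAt_Dt_concrete`** (`D̃` is strictly Fréchet-differentiable at every `A′` of the ball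
  with `𝔇(A′) = (I + ℜ)⁻¹ ∘ 𝒞′`), **`eq70_concrete`** (`fderiv ℂ D̃ A′ = (I + ℜ)⁻¹ ∘ 𝒞′`), `eq70_neumann_concrete` (`= (Σₙ(−ℜ)ⁿ) ∘ 𝒞′`),
  `eq68_concrete` (`(I + ℜ) ∘ 𝔇 = 𝒞′`), `eq63_concrete` (`(d/dτ)D̃(A′ + τδA′)|₀ = (I + ℜ)⁻¹𝒞′δA′`).
NOT CLAIMED: the KERNEL form of (69)/(71) (exponential decay in `d(c, c′)`; it needs the kernel bound of `H` from [5] Thm 3.12 — `H` is abstract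
here, rows B11.Eq45/B11.Eq70–73), (64)/(66) (r08's `eq66`, pure kernel algebra), anything about `Λ_j`/`𝔅_k` geometry.  NOT summit progress.
-/

noncomputable section

open scoped BigOperators Topology
open NormedSpace Finset Metric Filter

namespace Literature.MathematicalPhysics.QuantumFieldTheory.Balaban1983to89.B11Eq70Concrete

open B7Prop1Explicit B7Prop1Local B7Prop2Explicit B7Prop3Flat B7Prop4Flat B7Eq92Concrete B7Prop3GeneralLinear
  B7Prop4GeneralLevels B7Prop5GeneralOperators B7Prop5GeneralInduction B7Prop5GeneralLevels B7Ineq149Pairing B7Eq136SecondOrder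
  B7Eq136Expansion B13Contraction113 B11Eq56Expansion B11Eq44Concrete B12SecondOrder267Concrete B11Eq63FunctionalDerivative

-- `Site` alone would resolve to the torus sites of `Setup.lean`; re-export the `ℤ^d` sites of `B7Prop1Explicit`.
export B7Prop1Explicit (Site)

variable {d : ℕ}

section Regime

variable {𝔸 : Type*} [NormedRing 𝔸] [NormedAlgebra ℂ 𝔸] [CompleteSpace 𝔸] [NormOneClass 𝔸]

variable (L : ℕ) (hL : 2 ≤ L) {G : Subgroup 𝔸ˣ} (hG : AvgClosed d L G) (k : ℕ)
  (U₀ : Site d → Fin d → 𝔸ˣ) (hU₀ : ∀ x κ, U₀ x κ ∈ G) {α₀ : ℝ} (hα : 0 < α₀)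
  (hα3 : C0 d * α₀ ≤ 1 / 3) (hα4 : 4 * α₀ ≤ c2' d L) (h52 : pdev U₀ < α₀ * (((L : ℝ) ^ k)⁻¹) ^ 2)
  {b : ℝ} (hb : 0 < b)
  (hsmall : Real.exp (4 * (800 * ((d : ℝ) + 1) ^ 2 * ((d : ℝ) + 4)) * α₀)
    * (1 + 8 * (131072 * ((d : ℝ) + 1) ^ 2) * ((L : ℝ) ^ k * b)) ≤ 2)
  (hc₃ : 4 * ((L : ℝ) ^ k * b) < c3 d L)
  (S T : Finset (Site d × Fin d))

/-- print's `C₂` of (44) = [4] (135) at a general background (`B7Eq123General.prop4_general` (i)): `8·C₁·e^{4cα₀}`. -/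
local notation "C₂" => (8 * (131072 * ((d : ℝ) + 1) ^ 2) * Real.exp (4 * (800 * ((d : ℝ) + 1) ^ 2 * ((d : ℝ) + 4)) * α₀))

/-! ## §1 (69) in operator norm for the concrete `C_j`: `‖ℜ‖ ≤ 9C₂B₀ε₃ < 1` -/

include hL hG hU₀ hα hα3 hα4 h52 hb hsmall hc₃ in
/-- **(69) IN OPERATOR FORM, CONCRETE**: at any `X₀` with `‖X₀‖ ≤ 2ε` ((57)), `0 < ε`, `3ε < b`, the derivative of the concrete `Cmap` obeys
`‖𝒞′(X₀)h‖ ≤ 9·C₂(Lʲ)²·ε·‖h‖` for every direction `h` — r08's Cauchy estimate `ineq69` («(1/r)C₂(2ε₃ + r‖h‖)² at r = ε₃/‖h‖») fed with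
`B11Eq44Concrete.quadAnalytic_Cmap`, and (69) line 1 = (63) for `C_j` (`eq69_line1`, the derivative exists by [4] Prop. 4,
`B12SecondOrder267Concrete.analyticAt_Cmap`). [cite: Balaban1985Variational, (69) p.288] [cite: Balaban1985Averaging, Prop. 4 p.38] -/
theorem norm_fderiv_Cmap_apply_le {j : ℕ} (hj : j ≤ k) {ε : ℝ} (hε0 : 0 < ε) (hε : 3 * ε < b) {X₀ : S → 𝔸}
    (hX₀ : ‖X₀‖ ≤ 2 * ε) (h : S → 𝔸) :
    ‖fderiv ℂ (Cmap L U₀ S T j) X₀ h‖ ≤ 9 * (C₂ * ((L : ℝ) ^ j) ^ 2) * ε * ‖h‖ := by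
  have hC := quadAnalytic_Cmap L hL hG k U₀ hU₀ hα hα3 hα4 h52 hb hsmall hc₃ S T hj
  have hX₀b : ∀ s, ‖X₀ s‖ ≤ b := fun s => (norm_le_pi_norm X₀ s).trans (by linarith)
  have hF : HasFDerivAt (Cmap L U₀ S T j) (fderiv ℂ (Cmap L U₀ S T j) X₀) X₀ :=
    (analyticAt_Cmap L hL hG k U₀ hU₀ hα hα3 hα4 h52 hb hsmall hc₃ S T hj hX₀b).differentiableAt.hasFDerivAt
  by_cases hh : h = 0
  · subst hh; simp
  have hM : 0 < ‖h‖ := norm_pos_iff.mpr hh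
  rw [← eq69_line1 hF h]
  exact ineq69 hC (by positivity) hε0 hM hX₀ le_rfl hε

include hL hG hU₀ hα hα3 hα4 h52 hb hsmall hc₃ in
/-- the operator norm: `‖𝒞′(X₀)‖ ≤ 9C₂(Lʲ)²ε` for `‖X₀‖ ≤ 2ε`, `3ε < b`. [cite: Balaban1985Variational, (69) p.288] -/
theorem opNorm_fderiv_Cmap_le {j : ℕ} (hj : j ≤ k) {ε : ℝ} (hε0 : 0 < ε) (hε : 3 * ε < b) {X₀ : S → 𝔸}
    (hX₀ : ‖X₀‖ ≤ 2 * ε) : ‖fderiv ℂ (Cmap L U₀ S T j) X₀‖ ≤ 9 * (C₂ * ((L : ℝ) ^ j) ^ 2) * ε :=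
  ContinuousLinearMap.opNorm_le_bound _ (by positivity) fun h =>
    norm_fderiv_Cmap_apply_le L hL hG k U₀ hU₀ hα hα3 hα4 h52 hb hsmall hc₃ S T hj hε0 hε hX₀ h

variable (H : (T → 𝔸) →L[ℂ] (S → 𝔸)) {B₀ ε : ℝ}

include hL hG hU₀ hα hα3 hα4 h52 hb hsmall hc₃ in
/-- **«ℜ … is of the same type as the operators R»: `‖ℜ‖ ≤ 9C₂(Lʲ)²ε·B₀`** for `ℜ = 𝒞′(X₀) ∘ H`, `‖HX‖ ≤ B₀‖X‖` ((46)), `‖X₀‖ ≤ 2ε` — (69)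
summed into an operator bound. [cite: Balaban1985Variational, (69) p.288, (46) p.285] -/
theorem opNorm_R_le {j : ℕ} (hj : j ≤ k) (hB₀ : 0 ≤ B₀) (hH : ∀ X, ‖H X‖ ≤ B₀ * ‖X‖) (hε0 : 0 < ε) (hε : 3 * ε < b)
    {X₀ : S → 𝔸} (hX₀ : ‖X₀‖ ≤ 2 * ε) :
    ‖fderiv ℂ (Cmap L U₀ S T j) X₀ ∘L H‖ ≤ 9 * (C₂ * ((L : ℝ) ^ j) ^ 2) * ε * B₀ := by
  refine ContinuousLinearMap.opNorm_le_bound _ (by positivity) fun X => ?_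
  rw [ContinuousLinearMap.comp_apply]
  calc ‖fderiv ℂ (Cmap L U₀ S T j) X₀ (H X)‖ ≤ 9 * (C₂ * ((L : ℝ) ^ j) ^ 2) * ε * ‖H X‖ :=
        norm_fderiv_Cmap_apply_le L hL hG k U₀ hU₀ hα hα3 hα4 h52 hb hsmall hc₃ S T hj hε0 hε hX₀ (H X)
    _ ≤ 9 * (C₂ * ((L : ℝ) ^ j) ^ 2) * ε * (B₀ * ‖X‖) := mul_le_mul_of_nonneg_left (hH X) (by positivity)
    _ = 9 * (C₂ * ((L : ℝ) ^ j) ^ 2) * ε * B₀ * ‖X‖ := by ring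

include hL hG hU₀ hα hα3 hα4 h52 hb hsmall hc₃ in
/-- **`‖ℜ‖ < 1` under the contraction condition (54) «9C₂B₀ε₃ < 1»**. [cite: Balaban1985Variational, (54) p.286, (69) p.288] -/
theorem opNorm_R_lt_one {j : ℕ} (hj : j ≤ k) (hB₀ : 0 ≤ B₀) (hH : ∀ X, ‖H X‖ ≤ B₀ * ‖X‖) (hε0 : 0 < ε) (hε : 3 * ε < b)
    (hq : 9 * (C₂ * ((L : ℝ) ^ j) ^ 2) * B₀ * ε < 1) {X₀ : S → 𝔸} (hX₀ : ‖X₀‖ ≤ 2 * ε) :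
    ‖fderiv ℂ (Cmap L U₀ S T j) X₀ ∘L H‖ < 1 :=
  (opNorm_R_le L hL hG k U₀ hU₀ hα hα3 hα4 h52 hb hsmall hc₃ S T H hj hB₀ hH hε0 hε hX₀).trans_lt (by linarith)

include hL hG hU₀ hα hα3 hα4 h52 hb hsmall hc₃ in
/-- **«Equation (68) is uniquely solvable»: `I + ℜ` is invertible** (Neumann series, r08's `isInvertible_one_add_of_norm_lt_one`).
[cite: Balaban1985Variational, (70) p.289] -/
theorem isInvertible_one_add_R {j : ℕ} (hj : j ≤ k) (hB₀ : 0 ≤ B₀) (hH : ∀ X, ‖H X‖ ≤ B₀ * ‖X‖) (hε0 : 0 < ε) (hε : 3 * ε < b)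
    (hq : 9 * (C₂ * ((L : ℝ) ^ j) ^ 2) * B₀ * ε < 1) {X₀ : S → 𝔸} (hX₀ : ‖X₀‖ ≤ 2 * ε) :
    (1 + fderiv ℂ (Cmap L U₀ S T j) X₀ ∘L H).IsInvertible :=
  isInvertible_one_add_of_norm_lt_one _
    (opNorm_R_lt_one L hL hG k U₀ hU₀ hα hα3 hα4 h52 hb hsmall hc₃ S T H hj hB₀ hH hε0 hε hq hX₀)

/-! ## §2 The hypotheses of the implicit-function step, discharged for the concrete data -/

variable {Dt : (S → 𝔸) → (T → 𝔸)}

omit [CompleteSpace 𝔸] [NormOneClass 𝔸] in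
/-- **(57): `‖X₀‖ = ‖A′ − HD̃(A′)‖ ≤ 2ε`** for `‖A′‖ < ε`, `‖D̃(A′)‖ ≤ 4C₂(Lʲ)²ε²` and `4C₂(Lʲ)²B₀ε ≤ 1` («|A| ≦ |A′| + B₀…4C₂|A′|² < 2ε₃»).
[cite: Balaban1985Variational, (57) p.286] -/
theorem norm_X₀_le {j : ℕ} (hB₀ : 0 ≤ B₀) (hH : ∀ X, ‖H X‖ ≤ B₀ * ‖X‖) (hε0 : 0 < ε)
    (hq4 : 4 * (C₂ * ((L : ℝ) ^ j) ^ 2) * B₀ * ε ≤ 1) {A' : S → 𝔸} (hA : ‖A'‖ < ε)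
    (hD : Dt A' ∈ closedBall (0 : T → 𝔸) (4 * (C₂ * ((L : ℝ) ^ j) ^ 2) * ε ^ 2)) :
    ‖A' - H (Dt A')‖ ≤ 2 * ε := by
  have hDn : ‖Dt A'‖ ≤ 4 * (C₂ * ((L : ℝ) ^ j) ^ 2) * ε ^ 2 := mem_closedBall_zero_iff.1 hD
  have hHD : ‖H (Dt A')‖ ≤ ε := by
    refine (hH (Dt A')).trans ?_
    calc B₀ * ‖Dt A'‖ ≤ B₀ * (4 * (C₂ * ((L : ℝ) ^ j) ^ 2) * ε ^ 2) := mul_le_mul_of_nonneg_left hDn hB₀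
      _ = (4 * (C₂ * ((L : ℝ) ^ j) ^ 2) * B₀ * ε) * ε := by ring
      _ ≤ 1 * ε := mul_le_mul_of_nonneg_right hq4 hε0.le
      _ = ε := one_mul ε
  calc ‖A' - H (Dt A')‖ ≤ ‖A'‖ + ‖H (Dt A')‖ := norm_sub_le _ _
    _ ≤ ε + ε := add_le_add hA.le hHD
    _ = 2 * ε := by ring

omit [NormOneClass 𝔸] in
/-- **(49) HOLDS NEAR `A′`**: the fixed-point identity `D̃(A″) = Cmap(A″ − HD̃(A″))` on the open ball `‖A″‖ < ε` holds for all `A″` in a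
neighbourhood of any `A′` of that ball. [cite: Balaban1985Variational, (49) p.285] -/
theorem eventually_eq49 {j : ℕ} (hDfix : ∀ B : S → 𝔸, ‖B‖ < ε → Cmap L U₀ S T j (B - H (Dt B)) = Dt B) {A' : S → 𝔸}
    (hA : ‖A'‖ < ε) : ∀ᶠ A'' in 𝓝 A', Dt A'' = Cmap L U₀ S T j (A'' - H (Dt A'')) := by
  have hmem : ball (0 : S → 𝔸) ε ∈ 𝓝 A' := isOpen_ball.mem_nhds (mem_ball_zero_iff.2 hA)
  filter_upwards [hmem] with A'' hA''
  exact (hDfix A'' (mem_ball_zero_iff.1 hA'')).symm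

include hL hG hU₀ hα hα3 hα4 h52 hb hsmall hc₃ in
/-- **`C` IS STRICTLY DIFFERENTIABLE AT `X₀`** («it is analytic», p. 285 / [4] Prop. 4): `Cmap` is analytic at every point of the closed polydisc
`‖a_s‖ ≤ b` (`B12SecondOrder267Concrete.analyticAt_Cmap`), in particular at `X₀ = A′ − HD̃(A′)` with `‖X₀‖ ≤ 2ε ≤ b`.
[cite: Balaban1985Variational, (44) p.285, (57) p.286] [cite: Balaban1985Averaging, Prop. 4 p.38] -/
theorem hasStrictFDerivAt_Cmap_X₀ {j : ℕ} (hj : j ≤ k) {ε : ℝ} (hε : 2 * ε ≤ b) {X₀ : S → 𝔸} (hX₀ : ‖X₀‖ ≤ 2 * ε) :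
    HasStrictFDerivAt (Cmap L U₀ S T j) (fderiv ℂ (Cmap L U₀ S T j) X₀) X₀ := by
  have hX₀b : ∀ s, ‖X₀ s‖ ≤ b := fun s => (norm_le_pi_norm X₀ s).trans (hX₀.trans hε)
  have han := analyticAt_Cmap L hL hG k U₀ hU₀ hα hα3 hα4 h52 hb hsmall hc₃ S T hj hX₀b
  exact han.hasStrictFDerivAt

include hL hG hU₀ hα hα3 hα4 h52 hb hsmall hc₃ in
/-- **`D̃` IS CONTINUOUS AT `A′`** (p. 286 «a limit of uniformly convergent sequence … an analytic function of A′»): from the joint analyticity of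
`D̃` on the ball (`B12SecondOrder267Concrete.analyticOnNhd_Dt_concrete`). [cite: Balaban1985Variational, (54) p.286] -/
theorem continuousAt_Dt {j : ℕ} (hj : j ≤ k) (hB₀ : 0 ≤ B₀) (hH : ∀ X, ‖H X‖ ≤ B₀ * ‖X‖)
    (hq : 9 * (C₂ * ((L : ℝ) ^ j) ^ 2) * B₀ * ε < 1) (hε : 3 * ε ≤ b)
    (hDball : ∀ B : S → 𝔸, ‖B‖ < ε → Dt B ∈ closedBall (0 : T → 𝔸) (4 * (C₂ * ((L : ℝ) ^ j) ^ 2) * ε ^ 2))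
    (hDfix : ∀ B : S → 𝔸, ‖B‖ < ε → Cmap L U₀ S T j (B - H (Dt B)) = Dt B) {A' : S → 𝔸} (hA : ‖A'‖ < ε) :
    ContinuousAt Dt A' :=
  (analyticOnNhd_Dt_concrete L hL hG k U₀ hU₀ hα hα3 hα4 h52 hb hsmall hc₃ S T (H : (T → 𝔸) →ₗ[ℂ] (S → 𝔸)) hj hB₀ hH hq hε
    hDball hDfix A' (mem_ball_zero_iff.2 hA)).continuousAt

/-! ## §3 (63) and (70) for the concrete `C_j` -/

include hL hG hU₀ hα hα3 hα4 h52 hb hsmall hc₃ in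
/-- **THE FUNCTIONAL DERIVATIVE (63) EXISTS AND (70) HOLDS, FOR THE CONCRETE `C_j`**: for `H` with `‖HX‖ ≤ B₀‖X‖`, the contraction regime
`9C₂(Lʲ)²B₀ε < 1`, `3ε < b`, and ANY `D̃` with the fixed-point characterization (49)+(55) on `‖A″‖ < ε`, at every `A′` with `‖A′‖ < ε` the map
`D̃` is STRICTLY Fréchet-differentiable with `(δ/δA′)D̃(A′) = (I + ℜ)⁻¹ ∘ 𝒞′`, `𝒞′ = D[Cmap](A′ − HD̃(A′))`, `ℜ = 𝒞′ ∘ H` — r08's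
`B11Eq63FunctionalDerivative.hasStrictFDerivAt_of_eq49` (implicit function theorem) with its four hypotheses supplied by `eventually_eq49`,
`hasStrictFDerivAt_Cmap_X₀`, `continuousAt_Dt`, `isInvertible_one_add_R`. [cite: Balaban1985Variational, (63) p.287, (70) p.289] -/
theorem hasStrictFDerivAt_Dt_concrete {j : ℕ} (hj : j ≤ k) (hB₀ : 0 ≤ B₀) (hH : ∀ X, ‖H X‖ ≤ B₀ * ‖X‖)
    (hq : 9 * (C₂ * ((L : ℝ) ^ j) ^ 2) * B₀ * ε < 1) (hε : 3 * ε < b)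
    (hDball : ∀ B : S → 𝔸, ‖B‖ < ε → Dt B ∈ closedBall (0 : T → 𝔸) (4 * (C₂ * ((L : ℝ) ^ j) ^ 2) * ε ^ 2))
    (hDfix : ∀ B : S → 𝔸, ‖B‖ < ε → Cmap L U₀ S T j (B - H (Dt B)) = Dt B) {A' : S → 𝔸} (hA : ‖A'‖ < ε) :
    HasStrictFDerivAt Dt
      ((1 + fderiv ℂ (Cmap L U₀ S T j) (A' - H (Dt A')) ∘L H).inverse ∘L fderiv ℂ (Cmap L U₀ S T j) (A' - H (Dt A'))) A' := by
  have hε0 : 0 < ε := (norm_nonneg _).trans_lt hA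
  have hC2 : 0 ≤ C₂ * ((L : ℝ) ^ j) ^ 2 := by positivity
  have hq4 : 4 * (C₂ * ((L : ℝ) ^ j) ^ 2) * B₀ * ε ≤ 1 := by
    have hx : 0 ≤ C₂ * ((L : ℝ) ^ j) ^ 2 * B₀ * ε := mul_nonneg (mul_nonneg hC2 hB₀) hε0.le
    nlinarith
  have hX₀ := norm_X₀_le L S T H hB₀ hH hε0 hq4 hA (hDball A' hA)
  exact hasStrictFDerivAt_of_eq49 (eventually_eq49 L U₀ S T H hDfix hA)
    (hasStrictFDerivAt_Cmap_X₀ L hL hG k U₀ hU₀ hα hα3 hα4 h52 hb hsmall hc₃ S T hj (by linarith) hX₀)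
    (continuousAt_Dt L hL hG k U₀ hU₀ hα hα3 hα4 h52 hb hsmall hc₃ S T H hj hB₀ hH hq hε.le hDball hDfix hA)
    (isInvertible_one_add_R L hL hG k U₀ hU₀ hα hα3 hα4 h52 hb hsmall hc₃ S T H hj hB₀ hH hε0 hε hq hX₀)

include hL hG hU₀ hα hα3 hα4 h52 hb hsmall hc₃ in
/-- **(70) «𝔇(A′) = (I + ℜ)⁻¹L^{j(·)}η((δ/δA)C)(A′ − HD(A′))», CONCRETE**: `fderiv ℂ D̃ A′ = (I + ℜ)⁻¹ ∘ 𝒞′`.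
[cite: Balaban1985Variational, (70) p.289] -/
theorem eq70_concrete {j : ℕ} (hj : j ≤ k) (hB₀ : 0 ≤ B₀) (hH : ∀ X, ‖H X‖ ≤ B₀ * ‖X‖)
    (hq : 9 * (C₂ * ((L : ℝ) ^ j) ^ 2) * B₀ * ε < 1) (hε : 3 * ε < b)
    (hDball : ∀ B : S → 𝔸, ‖B‖ < ε → Dt B ∈ closedBall (0 : T → 𝔸) (4 * (C₂ * ((L : ℝ) ^ j) ^ 2) * ε ^ 2))
    (hDfix : ∀ B : S → 𝔸, ‖B‖ < ε → Cmap L U₀ S T j (B - H (Dt B)) = Dt B) {A' : S → 𝔸} (hA : ‖A'‖ < ε) :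
    fderiv ℂ Dt A' =
      (1 + fderiv ℂ (Cmap L U₀ S T j) (A' - H (Dt A')) ∘L H).inverse ∘L fderiv ℂ (Cmap L U₀ S T j) (A' - H (Dt A')) :=
  (hasStrictFDerivAt_Dt_concrete L hL hG k U₀ hU₀ hα hα3 hα4 h52 hb hsmall hc₃ S T H hj hB₀ hH hq hε hDball hDfix hA).hasFDerivAt.fderiv

include hL hG hU₀ hα hα3 hα4 h52 hb hsmall hc₃ in
/-- **(70) BY «A CONVERGENT NEUMANN SERIES», CONCRETE**: `(δ/δA′)D̃(A′) = (Σₙ (−ℜ)ⁿ) ∘ 𝒞′` (r08's `eq70_neumann`, `‖ℜ‖ < 1` by `opNorm_R_lt_one`).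
[cite: Balaban1985Variational, (70) p.289] -/
theorem eq70_neumann_concrete {j : ℕ} (hj : j ≤ k) (hB₀ : 0 ≤ B₀) (hH : ∀ X, ‖H X‖ ≤ B₀ * ‖X‖)
    (hq : 9 * (C₂ * ((L : ℝ) ^ j) ^ 2) * B₀ * ε < 1) (hε : 3 * ε < b)
    (hDball : ∀ B : S → 𝔸, ‖B‖ < ε → Dt B ∈ closedBall (0 : T → 𝔸) (4 * (C₂ * ((L : ℝ) ^ j) ^ 2) * ε ^ 2))
    (hDfix : ∀ B : S → 𝔸, ‖B‖ < ε → Cmap L U₀ S T j (B - H (Dt B)) = Dt B) {A' : S → 𝔸} (hA : ‖A'‖ < ε) :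
    HasFDerivAt Dt
      ((∑' n : ℕ, (-(fderiv ℂ (Cmap L U₀ S T j) (A' - H (Dt A')) ∘L H)) ^ n) ∘L
        fderiv ℂ (Cmap L U₀ S T j) (A' - H (Dt A'))) A' := by
  have hε0 : 0 < ε := (norm_nonneg _).trans_lt hA
  have hC2 : 0 ≤ C₂ * ((L : ℝ) ^ j) ^ 2 := by positivity
  have hq4 : 4 * (C₂ * ((L : ℝ) ^ j) ^ 2) * B₀ * ε ≤ 1 := by
    have hx : 0 ≤ C₂ * ((L : ℝ) ^ j) ^ 2 * B₀ * ε := mul_nonneg (mul_nonneg hC2 hB₀) hε0.le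
    nlinarith
  have hX₀ := norm_X₀_le L S T H hB₀ hH hε0 hq4 hA (hDball A' hA)
  exact eq70_neumann (eventually_eq49 L U₀ S T H hDfix hA)
    (hasStrictFDerivAt_Cmap_X₀ L hL hG k U₀ hU₀ hα hα3 hα4 h52 hb hsmall hc₃ S T hj (by linarith) hX₀)
    (continuousAt_Dt L hL hG k U₀ hU₀ hα hα3 hα4 h52 hb hsmall hc₃ S T H hj hB₀ hH hq hε.le hDball hDfix hA)
    (opNorm_R_lt_one L hL hG k U₀ hU₀ hα hα3 hα4 h52 hb hsmall hc₃ S T H hj hB₀ hH hε0 hε hq hX₀)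

include hL hG hU₀ hα hα3 hα4 h52 hb hsmall hc₃ in
/-- **(68) «(I + ℜ)𝔇 = Lʲη(δC_j/δA)(…)», CONCRETE**: `(I + ℜ) ∘ fderiv D̃ A′ = 𝒞′` (r08's `eq68`, the chain rule through (49)).
[cite: Balaban1985Variational, (68) p.288] -/
theorem eq68_concrete {j : ℕ} (hj : j ≤ k) (hB₀ : 0 ≤ B₀) (hH : ∀ X, ‖H X‖ ≤ B₀ * ‖X‖)
    (hq : 9 * (C₂ * ((L : ℝ) ^ j) ^ 2) * B₀ * ε < 1) (hε : 3 * ε < b)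
    (hDball : ∀ B : S → 𝔸, ‖B‖ < ε → Dt B ∈ closedBall (0 : T → 𝔸) (4 * (C₂ * ((L : ℝ) ^ j) ^ 2) * ε ^ 2))
    (hDfix : ∀ B : S → 𝔸, ‖B‖ < ε → Cmap L U₀ S T j (B - H (Dt B)) = Dt B) {A' : S → 𝔸} (hA : ‖A'‖ < ε) :
    (1 + fderiv ℂ (Cmap L U₀ S T j) (A' - H (Dt A')) ∘L H) ∘L fderiv ℂ Dt A' =
      fderiv ℂ (Cmap L U₀ S T j) (A' - H (Dt A')) := by
  have hε0 : 0 < ε := (norm_nonneg _).trans_lt hA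
  have hC2 : 0 ≤ C₂ * ((L : ℝ) ^ j) ^ 2 := by positivity
  have hq4 : 4 * (C₂ * ((L : ℝ) ^ j) ^ 2) * B₀ * ε ≤ 1 := by
    have hx : 0 ≤ C₂ * ((L : ℝ) ^ j) ^ 2 * B₀ * ε := mul_nonneg (mul_nonneg hC2 hB₀) hε0.le
    nlinarith
  have hX₀ := norm_X₀_le L S T H hB₀ hH hε0 hq4 hA (hDball A' hA)
  have hD := (hasStrictFDerivAt_Dt_concrete L hL hG k U₀ hU₀ hα hα3 hα4 h52 hb hsmall hc₃ S T H hj hB₀ hH hq hε hDball hDfix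
    hA).hasFDerivAt
  exact eq68 (eventually_eq49 L U₀ S T H hDfix hA) hD.differentiableAt.hasFDerivAt
    (hasStrictFDerivAt_Cmap_X₀ L hL hG k U₀ hU₀ hα hα3 hα4 h52 hb hsmall hc₃ S T hj (by linarith) hX₀).hasFDerivAt

include hL hG hU₀ hα hα3 hα4 h52 hb hsmall hc₃ in
/-- **(63) «⟨(δ/δA′)D(A′), δA′⟩ = (d/dτ)D(A′ + τδA′)|_{τ=0}», CONCRETE**: along every direction `δA′`,
`(d/dτ)D̃(A′ + τδA′)|₀ = ((I + ℜ)⁻¹ ∘ 𝒞′)(δA′)`. [cite: Balaban1985Variational, (63) p.287, (70) p.289] -/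
theorem eq63_concrete {j : ℕ} (hj : j ≤ k) (hB₀ : 0 ≤ B₀) (hH : ∀ X, ‖H X‖ ≤ B₀ * ‖X‖)
    (hq : 9 * (C₂ * ((L : ℝ) ^ j) ^ 2) * B₀ * ε < 1) (hε : 3 * ε < b)
    (hDball : ∀ B : S → 𝔸, ‖B‖ < ε → Dt B ∈ closedBall (0 : T → 𝔸) (4 * (C₂ * ((L : ℝ) ^ j) ^ 2) * ε ^ 2))
    (hDfix : ∀ B : S → 𝔸, ‖B‖ < ε → Cmap L U₀ S T j (B - H (Dt B)) = Dt B) {A' : S → 𝔸} (hA : ‖A'‖ < ε) (δ : S → 𝔸) :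
    HasDerivAt (fun τ : ℂ => Dt (A' + τ • δ))
      (((1 + fderiv ℂ (Cmap L U₀ S T j) (A' - H (Dt A')) ∘L H).inverse ∘L fderiv ℂ (Cmap L U₀ S T j) (A' - H (Dt A'))) δ) 0 :=
  eq63 (hasStrictFDerivAt_Dt_concrete L hL hG k U₀ hU₀ hα hα3 hα4 h52 hb hsmall hc₃ S T H hj hB₀ hH hq hε hDball hDfix hA).hasFDerivAt δ

end Regime

end Literature.MathematicalPhysics.QuantumFieldTheory.Balaban1983to89.B11Eq70Concrete

end
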